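import Summits.SmoothPoincare4.SmoothPoincare4.Theses.WeylBudget
import Literature.Geometry.Lorentzian.MetricValCongr
import Literature.Geometry.Riemannian.GeneralizedCylinderMeanCurvature
import Literature.Geometry.Riemannian.ChangGurskyYangProofs
import Literature.Geometry.Riemannian.RicciFlowScalarCurvatureComparison
import HarnessLib

/-!
# Bridge sub-goal T2 of crux `CorkRegluingBudget` (line `registered`, RESHAPE 3): the scalar
# curvature of the warped symmetric tube `ψ(t) ĥ ⊕ dt²` on `Y × ℝ`

Registered sub-goal `bridge_warpedTube_scalarCurvature` of `stub_warpedBridge` (item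
stmt-SmoothPoincare4-10831).  For a closed 3-manifold `Y`, a Riemannian metric `ĥ` on `Y`, a
smooth positive profile `ψ : ℝ → ℝ` and ANY smooth metric `G` on `Y × ℝ` (model
`(𝓡 3).prod 𝓘(ℝ, ℝ)`) with Levi-Civita connection whose value is the warped product
`G_{(z,t)}((V₁,V₂),(W₁,W₂)) = ψ(t) ĥ_z(V₁,W₁) + V₂ W₂`:
`ψ(t) · scal_G(z, t) = scal_ĥ(z) − 3 ψ''(t)` at every point.

Proof: `G` is a generalized cylinder (`G = g_t + dt²`, `g_t = ψ(t) ĥ`), so the printed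
Bär–Gauduchon–Moroianu / Bär–Hanke formula `cyl_scalarCurvature_eq_sum`
(`Literature/Geometry/Riemannian/GeneralizedCylinderMeanCurvature.lean`) gives, in a
`g_t`-orthogonal basis `β` of `T_zY`,
`scal_G = scal_{g_t} + 3|K_t|² − H_t² − ∑ᵢ g̈_t(βᵢ,βᵢ)/g_t(βᵢ,βᵢ)`.  Here `ġ_t = 2K_t`
(`hasDerivAt_cyl_val_two_mul`) gives the umbilic form `K_t = (ψ'/2) ĥ`, whence
`H_t = 3ψ'/(2ψ)`, `|K_t|² = 3ψ'²/(4ψ²)` (`trace_eq_sum_div_of_isOrthoᵢ`, `normSq_eq_sum_sq`), so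
`3|K_t|² − H_t² = 0`; `g̈_t(βᵢ,βᵢ)/g_t(βᵢ,βᵢ) = ψ''/ψ`; and `scal_{ψ(t) ĥ} = scal_ĥ/ψ(t)`
(`scalarCurvature_constSmul` with `scalarCurvature_congr_of_val_eq`).  Everything here is
proved; no definitions, no facts.
-/

set_option linter.dupNamespace false

open scoped Manifold ContDiff Topology
open Set Function

noncomputable section

namespace Summit.SmoothPoincare4.SmoothPoincare4.Theorems.CorkRegluingBudget

open Literature.Geometry.Lorentzian Literature.Geometry.Lorentzian.PseudoRiemannianMetric
  Literature.Geometry.Riemannian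

/-- **T2 — scalar curvature of the warped tube** (sub-goal `bridge_warpedTube_scalarCurvature` of
`stub_warpedBridge`, crux `CorkRegluingBudget`, line `registered` RESHAPE 3).  For ANY smooth
metric `G` on `Y × ℝ` whose value is the warped product `ψ(t) ĥ ⊕ dt²` (`ψ > 0` smooth, `ĥ`
Riemannian on the closed 3-manifold `Y`): `ψ · scal_G = scal_ĥ − 3 ψ''` pointwise (generalized
cylinder formula `scal_G = scal_{g_t} + 3 tr(W_t²) − (tr W_t)² − tr_{g_t} g̈_t` with `g_t = ψ(t) ĥ`;
equivalently the warped-product formula `scal = scal_ĥ/f² − 6f''/f − 6f'²/f²` with `f² = ψ`).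
[cite: BarHanke2023, §3 (9)] [cite: ONeill1983, Ch. 7, Cor. 7.43] -/
theorem bridge_warpedTube_scalarCurvature :
    ∀ (Y : Type) [TopologicalSpace Y] [T2Space Y] [SecondCountableTopology Y] [CompactSpace Y]
      [ChartedSpace (EuclideanSpace ℝ (Fin 3)) Y] [IsManifold (𝓡 3) ∞ Y]
      (ĥ : Literature.Geometry.Lorentzian.PseudoRiemannianMetric (𝓡 3) ∞ (EuclideanSpace ℝ (Fin 3))
        (TangentSpace (𝓡 3) : Y → Type _)) [ĥ.HasLeviCivita] (ψ : ℝ → ℝ)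
      (G : Literature.Geometry.Lorentzian.PseudoRiemannianMetric ((𝓡 3).prod 𝓘(ℝ, ℝ)) ∞
        (EuclideanSpace ℝ (Fin 3) × ℝ) (TangentSpace ((𝓡 3).prod 𝓘(ℝ, ℝ)) : Y × ℝ → Type _))
      [G.HasLeviCivita],
      ĥ.IsRiemannian → ContDiff ℝ ∞ ψ → (∀ t, 0 < ψ t) →
      (∀ (p : Y × ℝ) (V W : TangentSpace ((𝓡 3).prod 𝓘(ℝ, ℝ)) p),
        G.val p V W = ψ p.2 * ĥ.val p.1 V.1 W.1 + V.2 * W.2) →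
      ∀ p : Y × ℝ, ψ p.2 * G.scalarCurvature p =
        ĥ.scalarCurvature p.1 - 3 * iteratedDeriv 2 ψ p.2 := by
  intro Y _ _ _ _ _ _ ĥ _ ψ G _ hĥ hψ hpos hval p
  classical
  obtain ⟨z, t⟩ := p
  show ψ t * G.scalarCurvature (z, t) = ĥ.scalarCurvature z - 3 * iteratedDeriv 2 ψ t
  -- calculus of `ψ`
  have hψd : ∀ τ, HasDerivAt ψ (deriv ψ τ) τ := fun τ ↦
    ((contDiff_infty_iff_deriv.mp hψ).1 τ).hasDerivAt
  have hψd' : ∀ τ, HasDerivAt (deriv ψ) (deriv (deriv ψ) τ) τ := fun τ ↦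
    ((contDiff_infty_iff_deriv.mp (contDiff_infty_iff_deriv.mp hψ).2).1 τ).hasDerivAt
  have hψt : ψ t ≠ 0 := (hpos t).ne'
  -- the values of `G` on horizontal vectors
  have hG0 : ∀ (τ : ℝ) (v w : TangentSpace (𝓡 3) z),
      G.val (z, τ) ((v, 0) : TangentSpace ((𝓡 3).prod 𝓘(ℝ, ℝ)) (z, τ))
        ((w, 0) : TangentSpace ((𝓡 3).prod 𝓘(ℝ, ℝ)) (z, τ)) = ψ τ * ĥ.val z v w := by
    intro τ v w
    rw [hval]
    simp
  -- `G` is Riemannian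
  have hG : G.IsRiemannian := by
    intro q V hV
    rw [hval]
    rcases eq_or_ne V.1 0 with h1 | h1
    · have h2 : V.2 ≠ 0 := fun h2 ↦ hV (Prod.ext h1 h2)
      have h0 : ĥ.val q.1 V.1 = 0 := by rw [h1]; exact map_zero _
      rw [h0]
      simpa using mul_self_pos.2 h2
    · have : 0 < ψ q.2 * ĥ.val q.1 V.1 V.1 := mul_pos (hpos _) (hĥ q.1 V.1 h1)
      nlinarith [mul_self_nonneg V.2]
  -- the cylinder property
  have hcyl : ∀ (q : Y × ℝ) (v w : TangentSpace ((𝓡 3).prod 𝓘(ℝ, ℝ)) q),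
      G.val q v w = G.val q ((v.1, 0) : TangentSpace ((𝓡 3).prod 𝓘(ℝ, ℝ)) q)
        ((w.1, 0) : TangentSpace ((𝓡 3).prod 𝓘(ℝ, ℝ)) q) + v.2 * w.2 := by
    intro q v w
    rw [hval q v w, hval q]
    simp
  -- the slice metric `g_t = ψ(t) ĥ` and a `g_t`-orthogonal basis
  set hpb := contMDiff_pullbackBilin_holds (I := (𝓡 3).prod 𝓘(ℝ, ℝ)) (M := Y × ℝ) (I' := 𝓡 3)
    (N := Y) (n := (∞ : ℕ∞ω))
  have hfi := isSpacelikeImmersion_cylSlice G hG t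
  set gN := G.inducedMetric (fun y : Y ↦ ((y, t) : Y × ℝ)) hpb hfi
  have hgNval : ∀ (x : Y) (v w : TangentSpace (𝓡 3) x),
      gN.val x v w = ψ t * ĥ.val x v w := by
    intro x v w
    show G.val (x, t) (mfderiv (𝓡 3) ((𝓡 3).prod 𝓘(ℝ, ℝ)) (fun y : Y ↦ ((y, t) : Y × ℝ)) x v)
      (mfderiv (𝓡 3) ((𝓡 3).prod 𝓘(ℝ, ℝ)) (fun y : Y ↦ ((y, t) : Y × ℝ)) x w) = _
    rw [mfderiv_cylSlice_apply, mfderiv_cylSlice_apply, hval]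
    simp
  obtain ⟨e, he, hde⟩ := exists_isOrthoᵢ_basis gN z
  have hfin : Module.finrank ℝ (TangentSpace (𝓡 3) z) = 3 := finrank_euclideanSpace_fin
  set β : Module.Basis (Fin 3) ℝ (TangentSpace (𝓡 3) z) := e.reindex (finCongr hfin)
  have hβapply : ∀ k, β k = e ((finCongr hfin).symm k) := fun k ↦
    Module.Basis.reindex_apply _ _ _
  have hβ : (gN.toBilinForm z).IsOrthoᵢ β := by
    intro k l hkl
    simp only [Function.onFun, hβapply]
    exact he fun h ↦ hkl ((finCongr hfin).symm.injective h)
  have hdβ : ∀ k, gN.val z (β k) (β k) ≠ 0 := fun k ↦ by rw [hβapply]; exact hde _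
  have hĥβ : ∀ i, ĥ.val z (β i) (β i) ≠ 0 := fun i h ↦ hdβ i (by rw [hgNval, h, mul_zero])
  have hĥβ' : ∀ i j, i ≠ j → ĥ.val z (β i) (β j) = 0 := fun i j hij ↦ by
    have h : gN.val z (β i) (β j) = 0 := hβ hij
    rw [hgNval] at h
    exact (mul_eq_zero.1 h).resolve_left hψt
  -- the formula of Bär–Hanke
  have hmain := cyl_scalarCurvature_eq_sum G hG hcyl z t finrank_euclideanSpace_fin β hβ
  rw [hmain]
  -- (a) the scalar curvature of the slice `g_t = ψ(t) ĥ` is `scal_ĥ / ψ(t)`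
  haveI := gN.hasLeviCivita
  haveI : (ĥ.constSmul (ψ t) hψt).HasLeviCivita := HasLeviCivita.constSmul (ψ t) hψt
  have hscal : gN.scalarCurvature z = (ψ t)⁻¹ * ĥ.scalarCurvature z := by
    rw [← scalarCurvature_constSmul (g := ĥ) (ψ t) hψt z]
    refine scalarCurvature_congr_of_val_eq (fun x ↦ ?_) z
    ext v w
    rw [hgNval, constSmul_apply]
  -- (b) the second fundamental form of the slice is `K_t = (ψ'(t)/2) ĥ`
  have hK : ∀ v w : TangentSpace (𝓡 3) z,
      G.secondFundamentalForm (𝓡 3) (fun y : Y ↦ ((y, t) : Y × ℝ))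
        (fun y ↦ velocity ((𝓡 3).prod 𝓘(ℝ, ℝ)) (fun s : ℝ ↦ ((y, s) : Y × ℝ)) t) z v w =
        deriv ψ t / 2 * ĥ.val z v w := by
    intro v w
    have h1 := hasDerivAt_cyl_val_two_mul G hcyl z t v w
    have hfun : (fun τ ↦ G.val (z, τ) ((v, 0) : TangentSpace ((𝓡 3).prod 𝓘(ℝ, ℝ)) (z, τ))
        ((w, 0) : TangentSpace ((𝓡 3).prod 𝓘(ℝ, ℝ)) (z, τ))) = fun τ ↦ ψ τ * ĥ.val z v w :=
      funext fun τ ↦ hG0 τ v w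
    rw [hfun] at h1
    have h := h1.unique ((hψd t).mul_const (ĥ.val z v w))
    linarith
  -- (c) the mean curvature `H_t = m ψ'/(2ψ)`, `m = dim Y`
  have hH : G.meanCurvature (fun y : Y ↦ ((y, t) : Y × ℝ)) hpb hfi
      (fun y ↦ velocity ((𝓡 3).prod 𝓘(ℝ, ℝ)) (fun s : ℝ ↦ ((y, s) : Y × ℝ)) t) z =
      3 * (deriv ψ t / (2 * ψ t)) := by
    rw [meanCurvature, trace_eq_sum_div_of_isOrthoᵢ gN z β hβ hdβ]
    have hterm : ∀ i, G.secondFundamentalForm (𝓡 3) (fun y : Y ↦ ((y, t) : Y × ℝ))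
        (fun y ↦ velocity ((𝓡 3).prod 𝓘(ℝ, ℝ)) (fun s : ℝ ↦ ((y, s) : Y × ℝ)) t) z (β i)
          (β i) / gN.val z (β i) (β i) = deriv ψ t / (2 * ψ t) := fun i ↦ by
      have := hĥβ i
      rw [hK, hgNval]
      field_simp
    simp only [hterm, Finset.sum_const, Finset.card_univ, Fintype.card_fin, nsmul_eq_mul,
      Nat.cast_ofNat]
  -- (d) `|K_t|² = m ψ'²/(4ψ²)`
  have hN : gN.normSq z (G.secondFundamentalForm (𝓡 3) (fun y : Y ↦ ((y, t) : Y × ℝ))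
        (fun y ↦ velocity ((𝓡 3).prod 𝓘(ℝ, ℝ)) (fun s : ℝ ↦ ((y, s) : Y × ℝ)) t) z) =
      3 * (deriv ψ t / (2 * ψ t)) ^ 2 := by
    rw [normSq_eq_sum_sq gN z β hβ hdβ]
    have hterm : ∀ i, ∑ j, G.secondFundamentalForm (𝓡 3) (fun y : Y ↦ ((y, t) : Y × ℝ))
        (fun y ↦ velocity ((𝓡 3).prod 𝓘(ℝ, ℝ)) (fun s : ℝ ↦ ((y, s) : Y × ℝ)) t) z (β j)
          (β i) ^ 2 / (gN.val z (β i) (β i) * gN.val z (β j) (β j)) =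
        (deriv ψ t / (2 * ψ t)) ^ 2 := fun i ↦ by
      rw [Finset.sum_eq_single i]
      · have := hĥβ i
        rw [hK, hgNval]
        field_simp
      · intro j _ hji
        rw [hK, hĥβ' j i hji]
        simp
      · intro h; exact absurd (Finset.mem_univ i) h
    simp only [hterm, Finset.sum_const, Finset.card_univ, Fintype.card_fin, nsmul_eq_mul,
      Nat.cast_ofNat]
  -- (e) `tr_{g_t} g̈_t = m ψ''/ψ`
  have hdd : ∀ i, deriv (fun τ ↦ deriv (fun σ ↦ G.val (z, σ)
      ((β i, 0) : TangentSpace ((𝓡 3).prod 𝓘(ℝ, ℝ)) (z, σ))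
      ((β i, 0) : TangentSpace ((𝓡 3).prod 𝓘(ℝ, ℝ)) (z, σ))) τ) t /
      G.val (z, t) ((β i, 0) : TangentSpace ((𝓡 3).prod 𝓘(ℝ, ℝ)) (z, t))
        ((β i, 0) : TangentSpace ((𝓡 3).prod 𝓘(ℝ, ℝ)) (z, t)) =
      iteratedDeriv 2 ψ t / ψ t := by
    intro i
    have hfun : (fun σ ↦ G.val (z, σ)
        ((β i, 0) : TangentSpace ((𝓡 3).prod 𝓘(ℝ, ℝ)) (z, σ))
        ((β i, 0) : TangentSpace ((𝓡 3).prod 𝓘(ℝ, ℝ)) (z, σ))) =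
        fun σ ↦ ψ σ * ĥ.val z (β i) (β i) :=
      funext fun σ ↦ hG0 σ (β i) (β i)
    have hd1 : deriv (fun σ ↦ ψ σ * ĥ.val z (β i) (β i)) =
        fun τ ↦ deriv ψ τ * ĥ.val z (β i) (β i) :=
      funext fun τ ↦ ((hψd τ).mul_const _).deriv
    rw [hfun, hG0, hd1, ((hψd' t).mul_const _).deriv, iteratedDeriv_succ, iteratedDeriv_one]
    have := hĥβ i
    field_simp
  -- (f) the algebra
  rw [hscal, hN, hH]
  simp only [hdd, Finset.sum_const, Finset.card_univ, Fintype.card_fin, nsmul_eq_mul,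
    Nat.cast_ofNat]
  field_simp
  ring

end Summit.SmoothPoincare4.SmoothPoincare4.Theorems.CorkRegluingBudget

end

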